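import Literature.MathematicalPhysics.QuantumLattice.DWaveSourceNNNHoppingFlatTwist
import Literature.MathematicalPhysics.QuantumLattice.PeierlsHubbardTimeReversal
import HarnessLib

/-!
# Time reversal of the flat-twisted pair-sourced `t–t'` torus: `conj H(h, n) = H(h, −n)`, `E₀(h, −n) = E₀(h, n)`

Topic `Literature/MathematicalPhysics/QuantumLattice` (namespace = path; family `hubbard`). Sequel of
`DWaveSourceNNNHoppingFlatTwist.lean` (`dWaveSourceTorusTT'Twist L t' U μ h n`: flat twist `χ(n_i)` on every bond,
untwisted real `d`-wave pair source) and `PeierlsHubbardTimeReversal.lean` (`groundEnergy_map_conj`: entrywise complex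
conjugation preserves the ground energy of a Hermitian matrix). In the real Jordan–Wigner basis complex conjugation
fixes the pair field, the number operator and the interaction and inverts every bond phase, so it maps the twist `n`
to `−n`: the sourced helicity chord of row T8 (`sourced-helicity-chord`, Hubbard cuprate cell `hubbard-cq`) is EVEN in
the twist, `E₀(h, −n) = E₀(h, n)` — half the twist grid suffices in any computation.

* `bondPairAnn_map_conj`, `pairField_map_conj`, `conjTranspose_map_conj_of_map_conj`, `totalNumber_map_conj` — the
  pair field, its adjoint and `N` are real matrices;
* `flatTwistConfig_neg`, `flatTwistDiagAmp_neg` — reversing `n` inverts / conjugates the bond phases;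
* `hubbardTorusTT'Twist_map_conj`, **`dWaveSourceTorusTT'Twist_map_conj`**: `conj H(h, n) = H(h, −n)`;
* **`groundEnergy_dWaveSourceTorusTT'Twist_neg`**: `E₀(dWaveSourceTorusTT'Twist L t' U μ h (−n)) = E₀(… n)`.

HONEST SCOPE: finite-volume symmetry bookkeeping; no number, no limit, nothing about superconductivity. All PROVED,
no definition.

## References
* N. Byers, C. N. Yang, Phys. Rev. Lett. 7 (1961) 46 (time reversal `Φ ↦ −Φ`). [cite: ByersYang1961]
* H. Watanabe, J. Stat. Phys. 177 (2019) 717, §2.2.1. [cite: Watanabe2019, §2.2.1]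
-/

noncomputable section

namespace Literature.MathematicalPhysics.QuantumLattice

open _root_.Matrix Finset Literature.Probability.LatticeModels HubbardWave0
open scoped ComplexConjugate

/-! ### Real matrices: the pair field, its adjoint, the number operator -/

section Real

variable {Λ : Type*} [LinearOrder Λ] [Fintype Λ]

/-- The singlet bond pair `d_{yz}` is a real matrix in the Jordan–Wigner basis. [cite: ByersYang1961] -/
theorem bondPairAnn_map_conj (y z : Λ) :
    (bondPairAnn y z).map (starRingEnd ℂ) = bondPairAnn y z := by
  unfold bondPairAnn
  rw [Matrix.map_sub _ (map_sub _), Matrix.map_mul, Matrix.map_mul, annihilation_map_conj, annihilation_map_conj,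
    annihilation_map_conj, annihilation_map_conj]

/-- `N = Σ n_{xσ}` is a real matrix. [cite: ByersYang1961] -/
theorem totalNumber_map_conj :
    (totalNumber : Matrix (Finset (Orb Λ)) (Finset (Orb Λ)) ℂ).map (starRingEnd ℂ) = totalNumber := by
  unfold totalNumber numberOp
  simp only [map_conj_sum, Matrix.map_mul, creation_map_conj, annihilation_map_conj]

omit [LinearOrder Λ] [Fintype Λ] in
/-- If `A` is real then so is `Aᴴ` (`= Aᵀ`). [cite: ByersYang1961] -/
theorem conjTranspose_map_conj_of_map_conj {m : Type*} {A : Matrix m m ℂ} (hA : A.map (starRingEnd ℂ) = A) :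
    Aᴴ.map (starRingEnd ℂ) = Aᴴ := by
  ext i j
  have hij : (starRingEnd ℂ) (A j i) = A j i := by simpa [Matrix.map_apply] using congrFun (congrFun hA j) i
  simp only [Matrix.map_apply, Matrix.conjTranspose_apply, Complex.star_def, Complex.conj_conj]
  exact hij.symm

end Real

variable (L : ℕ) [NeZero L]

/-- **The pair field is a real matrix**: `conj Δ_g = Δ_g` entrywise (real form factor, real Jordan–Wigner matrices).
[cite: ByersYang1961] -/
theorem pairField_map_conj (g : Site 2 → ℝ) : (pairField g L).map (starRingEnd ℂ) = pairField g L := by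
  rw [pairField, map_conj_sum]
  refine Finset.sum_congr rfl fun x _ => ?_
  rw [localPair_eq_sum_bondPairAnn, map_conj_sum]
  refine Finset.sum_congr rfl fun e _ => ?_
  rw [map_conj_smul, Complex.conj_ofReal, bondPairAnn_map_conj]

/-- The real pair source `Δ_g + Δ_gᴴ` is a real matrix. [cite: ByersYang1961] -/
theorem pairField_add_conjTranspose_map_conj (g : Site 2 → ℝ) :
    (pairField g L + (pairField g L)ᴴ).map (starRingEnd ℂ) = pairField g L + (pairField g L)ᴴ := by
  rw [Matrix.map_add _ (map_add _), pairField_map_conj, conjTranspose_map_conj_of_map_conj (pairField_map_conj L g)]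

/-! ### Reversing the twist -/

/-- Reversing the twist inverts the nearest-neighbour phases: `flatTwistConfig L (−n) = (flatTwistConfig L n)⁻¹`.
[cite: ByersYang1961] -/
theorem flatTwistConfig_neg (n : Fin 2 → ZMod L) : flatTwistConfig L (-n) = (flatTwistConfig L n)⁻¹ := by
  funext e
  simp only [flatTwistConfig, Pi.inv_apply, Pi.neg_apply, AddChar.map_neg_eq_inv]

/-- Reversing the twist conjugates the diagonal amplitudes. [cite: ByersYang1961] -/
theorem flatTwistDiagAmp_neg (n : Fin 2 → ZMod L) :
    flatTwistDiagAmp L (-n) = fun s x => conj (flatTwistDiagAmp L n s x) := by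
  funext s x
  simp only [flatTwistDiagAmp, Pi.neg_apply, ← Circle.coe_inv_eq_conj, ← AddChar.map_neg_eq_inv]
  congr 2
  ring

/-- **Time reversal of the twisted hopping**: `conj hubbardTorusTT'Twist L t' U n = hubbardTorusTT'Twist L t' U (−n)`.
[cite: ByersYang1961] -/
theorem hubbardTorusTT'Twist_map_conj (t' U : ℝ) (n : Fin 2 → ZMod L) :
    (hubbardTorusTT'Twist L t' U n).map (starRingEnd ℂ) = hubbardTorusTT'Twist L t' U (-n) := by
  rw [hubbardTorusTT'Twist, hubbardTorusTT'Twist, Matrix.map_add _ (map_add _), magneticHubbardTorus_map_conj,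
    map_conj_smul, diagPeierlsHopping_map_conj, flatTwistConfig_neg, flatTwistDiagAmp_neg, map_neg, Complex.conj_ofReal]

/-- **TIME REVERSAL OF THE FLAT-TWISTED SOURCED TORUS**: `conj H(h, n) = H(h, −n)` entrywise. [cite: ByersYang1961] -/
theorem dWaveSourceTorusTT'Twist_map_conj (t' U μ h : ℝ) (n : Fin 2 → ZMod L) :
    (dWaveSourceTorusTT'Twist L t' U μ h n).map (starRingEnd ℂ) = dWaveSourceTorusTT'Twist L t' U μ h (-n) := by
  rw [dWaveSourceTorusTT'Twist, dWaveSourceTorusTT'Twist, Matrix.map_sub _ (map_sub _), Matrix.map_sub _ (map_sub _),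
    hubbardTorusTT'Twist_map_conj, map_conj_smul, totalNumber_map_conj, Complex.conj_ofReal, map_conj_smul,
    pairField_add_conjTranspose_map_conj, Complex.conj_ofReal]

/-- **The sourced helicity chord is even in the twist**: `E₀(h, −n) = E₀(h, n)` for the grand-canonical ground energy of
`dWaveSourceTorusTT'Twist`. [cite: ByersYang1961] -/
theorem groundEnergy_dWaveSourceTorusTT'Twist_neg (t' U μ h : ℝ) (n : Fin 2 → ZMod L) :
    (dWaveSourceTorusTT'Twist L t' U μ h (-n)).groundEnergy = (dWaveSourceTorusTT'Twist L t' U μ h n).groundEnergy := by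
  haveI : Nonempty (Finset (Orb (FermionTorus 2 L))) := ⟨∅⟩
  rw [← dWaveSourceTorusTT'Twist_map_conj]
  exact groundEnergy_map_conj (isHermitian_dWaveSourceTorusTT'Twist L t' U μ h n)

end Literature.MathematicalPhysics.QuantumLattice
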